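import Literature.NumberTheory.Weil1965.ThetaIntegralHermNormSplit
import Literature.NumberTheory.Weil1965.ThetaIntegralGeometricActionAtPlace
import Literature.NumberTheory.Weil1965.ThetaIntegralGeometricActionLocal
import HarnessLib

/-!
# H413 · E-2 · SW2 (iii) — THE SPLIT-PLACE FRAME (binder (SPLIT-v ∘ BRIDGE-v) of the I-CLOSE assembly)

Cell `hodgecm-mathlib`, crux H413 (`stmt-HodgeConjecture-24833`), child line `Cruxes/H413/Lines/F0_E2SiegelWeilWeilRange.lean`,
`StubSW2` (iii); pen sheet `F0/P4/F0P2a-p08/SW2-ICLOSE-ASSEMBLY.v0` §1 (BRIDGE-v) and §2 step (1); outer assembly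
`Theorems/H413E2SWIdentityClose` (T2b) of B-p03.  PROOF lane, `--supports stmt-HodgeConjecture-24833 --as helper`.  HC_CM is
proved only modulo the 7 printed citations until rung 0 closes; nothing in this file is about Hodge classes.

THE MATHEMATICS (A. Weil, *Acta Math.* 113 (1965), Chap. V n° 50, pp. 73–74): fix an auxiliary finite place `v` of `F` SPLIT in
`E = F(δ)` (`s² = d = δ²` in `F_v`).  Then `X_A = X_v × X′` (★ `AdelicVector.placeSplitting`), the hermitian norm read at `v` is the
split pairing `(x, y) ↦ x ⬝ᵥ y` in suitable coordinates `β_v` of `X_v` (★ `ThetaIntegralHermNormSplit.exists_splitBeta_adicCompletion`),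
and the `v`-member `U(J_V)(F_v) ≅ GL_n(F_v)` of the dual pair acts on `X_v` through `(g, (g⁻¹)ᵀ)` and trivially on `X′`.  This file
PACKAGES these facts as the one existential the outer assembly consumes:

* `map_adeleToLocal_adelicInl_eq_kroneckerGL`, `map_adeleToLocal_adelicInl_inclPlaceAdelic` — `(h ⊗ 1)|_v = h|_v ⊗ 1` and, for the
  `v`-supported `ι_v u` (★ `UnitaryGroupPlaceInclusion.inclPlaceAdelic`), `(ι_v u ⊗ 1)|_v = u ⊗ 1 = kroneckerGL (u, 1)`;
* **`exists_vSupported_realising`** — every `P ∈ GL_n(F_v)` is realised by a `v`-supported `h ∈ U(J_V)(𝔸_F)`: (i) `A_h y = y` on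
  `X□(𝔸_F)^{(v)}` (★ `ThetaIntegralGeometricActionLocal.vDiagAct_inclPlaceAdelic_apply_of_mem`), (ii)
  `β_v ((A_h x)_v) = (P (β_v x_v).1, (P⁻¹)ᵀ (β_v x_v).2)` (★ `ThetaIntegralGeometricActionAtPlace.evalAt_vDiagAct_comp` — the
  `v`-component of the geometric action is the local action of `(h ⊗ 1)|_v` — and ★ `ThetaIntegralHermNormSplit.exists_mem_local_of_gl` ∕
  `kroneckerGL_one_mem_pairForm` ∕ `exists_gl_split_intertwine_adicCompletion`);
* **`exists_splitPlaceFrame`** — `∃ β_v`, (E1) `(hNorm x)_v = (β_v x_v).1 ⬝ᵥ (β_v x_v).2` (★ `evalAt_hNorm`), (E2) `β_v` carries Haar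
  measure to `c • (Haar ⊗ Haar)`, (E3) = `exists_vSupported_realising` for every `P` (incl. (iii): the `X□(𝔸_F)^{(v)}`-component of
  `placeSplitting⁻¹ (A_h x)` is that of `placeSplitting⁻¹ x`);
* **`map_dualAct_frame_eq`** — INVARIANCE TRANSPORT: `A_h`-invariance of a measure `μ` on `X□(𝔸_F)` (with (i), (ii)) gives the
  `(P, (P⁻¹)ᵀ) × id`-invariance of its image under `e = (β_v × id) ∘ placeSplitting⁻¹` — the `hinv` of
  ★ `H413E2SWIdentityCloseSplit.marginal_eq_smul_marginal_of_dilate_bound` by evaluation on rectangles.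

With `e := (β_v × id) ∘ placeSplitting⁻¹ : X□(𝔸_F) ≃ (X_v × Y_v) × X□(𝔸_F)^{(v)}` (★ p807976, ★ p808785
`AdelicVector.placeSplitting_symm_linearMap_of_forall_mem`, `map_prodMap_map_placeSplitting_symm`) the consumer reads (E1) as the
`hNorm`-clause, (E3)(i)+(ii) as `e (A_h x) = ((P, P⁻ᵀ) (e x).1, (e x).2)`, and transports the `U(J_V)(𝔸_F)`-invariance of the fibre
measures to the `GL_n(F_v)`-invariance of their `e`-images (Weil n° 49 Lemme 22 ∕ ★ `SplitPlaceFibreMeasureInvariance`).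

References: A. Weil, *Sur la formule de Siegel dans la théorie des groupes classiques*, Acta Math. 113 (1965), Chap. V n° 49
Lemme 22 p. 70, n° 50 pp. 73–74 [Weil1965]; S. Gelbart, J. Rogawski, Invent. Math. 105 (1991), §3.1–§3.2 pp. 454–457
[GelbartRogawski1991]; V. Platonov, A. Rapinchuk, *Algebraic Groups and Number Theory* (1994), §5.1 [PlatonovRapinchuk1994].
-/

set_option autoImplicit false
-- the cell's `Summit.HodgeConjecture.HodgeConjecture.…` namespace repeats the summit name by design (D-0017 layout)
set_option linter.dupNamespace false

noncomputable section

namespace Summit.HodgeConjecture.HodgeConjecture.Cruxes.H413.E2SWSplitPlaceFrame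

open scoped Matrix Kronecker NNReal ENNReal
open _root_.MeasureTheory NumberField IsDedekindDomain
open Literature.RepresentationTheory.HeisenbergGroup
open Literature.RepresentationTheory.HeisenbergGroup.SymplecticMatrix
open Literature.NumberTheory.Weil1964 Literature.NumberTheory.Weil1965 Literature.NumberTheory.Weil1965.UnitaryDoubling
open Literature.NumberTheory.Automorphic Literature.NumberTheory.Automorphic.UnitaryGroup
open Literature.NumberTheory.Automorphic.UnitaryGroup.QuadraticCoordinates
open Literature.NumberTheory.GelbartRogawski1991 Literature.NumberTheory.GelbartRogawski1991.UnitaryDualPair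
open Literature.NumberTheory.Automorphic.AdelicVector (evalAt evalAt_apply trivialAt placeSplitting single evalAt_single)

variable (F E : Type) [Field F] [NumberField F] [Field E] [NumberField E] [Algebra F E] [Algebra.IsQuadraticExtension F E]
  (c : E ≃ₐ[F] E) {δ : E} (hcδ : c δ = -δ) (hδ : δ ≠ 0) {d : F} (hd : δ * δ = algebraMap F E d)
  (N : ℕ) {n : ℕ} (e : Fin N × Fin 1 ≃ Fin n)
  (TV : Matrix (Fin N) (Fin N) F) (hV : TV.IsSymm) (hVd : IsUnit TV.det)
  (TW : Matrix (Fin 1) (Fin 1) F) (hW : TW.IsSymm) (hWd : IsUnit TW.det)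
  (v : HeightOneSpectrum (𝓞 F))

omit [NumberField F] [Algebra.IsQuadraticExtension F E] in
/-- **`(h ⊗ 1)|_v = h|_v ⊗ 1`** as elements of `GL_{N×1}(E ⊗ F_v)`. [cite: GelbartRogawski1991, §3.2 p. 457] -/
theorem map_adeleToLocal_adelicInl_eq_kroneckerGL (h : UnitaryGroup.adelic F E c N (TV.map (algebraMap F E))) :
    Matrix.GeneralLinearGroup.map (adeleToLocal E v)
        ((adelicInl F E c N 1 (TV.map (algebraMap F E)) (TW.map (algebraMap F E)) h :
          adelicPair F E c N 1 (TV.map (algebraMap F E)) (TW.map (algebraMap F E))) : GL (Fin N × Fin 1) (AdeleRing (𝓞 E) E)) =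
      kroneckerGL (Matrix.GeneralLinearGroup.map (adeleToLocal E v) (h : GL (Fin N) (AdeleRing (𝓞 E) E)), 1) := by
  refine Units.ext ?_
  rw [coe_kroneckerGL]
  change ((((adelicInl F E c N 1 (TV.map (algebraMap F E)) (TW.map (algebraMap F E)) h :
      adelicPair F E c N 1 (TV.map (algebraMap F E)) (TW.map (algebraMap F E))) : GL (Fin N × Fin 1) (AdeleRing (𝓞 E) E)) :
        Matrix (Fin N × Fin 1) (Fin N × Fin 1) (AdeleRing (𝓞 E) E)).map (adeleToLocal E v)) =
    ((h : GL (Fin N) (AdeleRing (𝓞 E) E)) : Matrix (Fin N) (Fin N) (AdeleRing (𝓞 E) E)).map (adeleToLocal E v) ⊗ₖ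
      ((1 : GL (Fin 1) (LocalRing E v)) : Matrix (Fin 1) (Fin 1) (LocalRing E v))
  rw [coe_adelicInl, Units.val_one]
  ext ⟨i, i'⟩ ⟨j, j'⟩
  simp only [Matrix.map_apply, Matrix.kroneckerMap_apply, map_mul, Matrix.one_apply]
  split_ifs <;> simp

omit [Algebra.IsQuadraticExtension F E] in
/-- **`(ι_v u ⊗ 1)|_v = u ⊗ 1`**: the `v`-supported element `ι_v u` read above `v`, tensored with `1`, is the local Kronecker
element `kroneckerGL (u, 1)` (★ `map_adeleToLocal_adelicVal_inclPlaceAdelic`). [cite: PlatonovRapinchuk1994, §5.1] -/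
theorem map_adeleToLocal_adelicInl_inclPlaceAdelic (u : localPi E c N (TV.map (algebraMap F E)) v) :
    Matrix.GeneralLinearGroup.map (adeleToLocal E v)
        ((adelicInl F E c N 1 (TV.map (algebraMap F E)) (TW.map (algebraMap F E))
            (inclPlaceAdelic F E c N (TV.map (algebraMap F E)) v u) :
          adelicPair F E c N 1 (TV.map (algebraMap F E)) (TW.map (algebraMap F E))) : GL (Fin N × Fin 1) (AdeleRing (𝓞 E) E)) =
      kroneckerGL (((localPiEquiv E c N (TV.map (algebraMap F E)) v u : «local» E c N (TV.map (algebraMap F E)) v) :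
        GL (Fin N) (LocalRing E v)), 1) := by
  rw [map_adeleToLocal_adelicInl_eq_kroneckerGL, ← adelicVal_apply, map_adeleToLocal_adelicVal_inclPlaceAdelic]


/-- **Every `P ∈ GL_n(F_v)` is realised by a `v`-SUPPORTED element of `U(J_V)(𝔸_F)`** acting, at `v` and in the split
coordinates `β_v`, as the dual pair `(P ·, (P⁻¹)ᵀ ·)`, and trivially away from `v`: for `h := ι_v u` with `u ∈ U(J_V)(F_v)` chosen by
★ `exists_mem_local_of_gl`, (i) `A_h y = y` for `y ∈ X□(𝔸_F)^{(v)}` (★ `vDiagAct_inclPlaceAdelic_apply_of_mem`) and (ii)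
`β_v ((A_h x)_v) = (P (β_v x_v).1, (P⁻¹)ᵀ (β_v x_v).2)` (★ `evalAt_vDiagAct_comp` + ★ `exists_gl_split_intertwine_adicCompletion`).
Weil (1965) n° 50: at the auxiliary split place `U(i)_v ≅ GL(m, 𝔎_v)` acts on `X_v` through `(g, g⁻ᵀ)`; n° 49 Lemme 22 then applies.
[cite: Weil1965, Chap. V n° 50, pp. 73–74] -/
theorem exists_vSupported_realising {s : v.adicCompletion F} (hs : s * s = algebraMap F (v.adicCompletion F) d)
    (β : (Fin (n + n) → v.adicCompletion F) ≃ₗ[v.adicCompletion F] ((Fin n → v.adicCompletion F) × (Fin n → v.adicCompletion F)))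
    (hβ : ∀ y, β y =
        ((fun i => y (Fin.castAdd n i)) +
            s • ((UnitaryDualPair.gram F e TV TW).map (algebraMap F (v.adicCompletion F)))⁻¹ *ᵥ (fun i => y (Fin.natAdd n i)),
          (UnitaryDualPair.gram F e TV TW).map (algebraMap F (v.adicCompletion F)) *ᵥ (fun i => y (Fin.castAdd n i)) -
            s • (fun i => y (Fin.natAdd n i))))
    (P : GL (Fin n) (v.adicCompletion F)) :
    ∃ h : UnitaryGroup.adelic F E c N (TV.map (algebraMap F E)),
      (∀ y ∈ trivialAt F (Fin (n + n)) v, vDiagAct F E c hcδ hδ hd N e TV hV hVd TW hW hWd h y = y) ∧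
      (∀ x : Fin (n + n) → AdeleRing (𝓞 F) F,
        β (evalAt F (Fin (n + n)) v (vDiagAct F E c hcδ hδ hd N e TV hV hVd TW hW hWd h x)) =
          ((P : Matrix (Fin n) (Fin n) (v.adicCompletion F)) *ᵥ (β (evalAt F (Fin (n + n)) v x)).1,
            ((P⁻¹ : GL (Fin n) (v.adicCompletion F)) : Matrix (Fin n) (Fin n) (v.adicCompletion F))ᵀ *ᵥ
              (β (evalAt F (Fin (n + n)) v x)).2)) ∧
      (∀ x : Fin (n + n) → AdeleRing (𝓞 F) F,
        ((placeSplitting F (Fin (n + n)) v).symm (vDiagAct F E c hcδ hδ hd N e TV hV hVd TW hW hWd h x)).2 =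
          ((placeSplitting F (Fin (n + n)) v).symm x).2) := by
  -- the local element `u ∈ U(J_V)(F_v)` with `(u ⊗ 1)_w = P`, lifted at `v`
  obtain ⟨u, hu, hP⟩ := exists_mem_local_of_gl F E c hcδ hδ hd N e TV hV hVd v hs P
  set uπ : localPi E c N (TV.map (algebraMap F E)) v := (localPiEquiv E c N (TV.map (algebraMap F E)) v).symm ⟨u, hu⟩ with huπ
  set h : UnitaryGroup.adelic F E c N (TV.map (algebraMap F E)) := inclPlaceAdelic F E c N (TV.map (algebraMap F E)) v uπ with hh
  refine ⟨h, fun y hy => vDiagAct_inclPlaceAdelic_apply_of_mem F E c hcδ hδ hd N e TV hV hVd TW hW hWd v uπ hy, fun x => ?_,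
    fun x => (congrArg Prod.snd (placeSplitting_symm_vDiagAct_inclPlaceAdelic F E c hcδ hδ hd N e TV hV hVd TW hW hWd v uπ x)).trans rfl⟩
  -- the local image of `h ⊗ 1` is `u ⊗ 1`
  have hGL : Matrix.GeneralLinearGroup.map (adeleToLocal E v)
      ((adelicInl F E c N 1 (TV.map (algebraMap F E)) (TW.map (algebraMap F E)) h :
        adelicPair F E c N 1 (TV.map (algebraMap F E)) (TW.map (algebraMap F E))) : GL (Fin N × Fin 1) (AdeleRing (𝓞 E) E)) =
      kroneckerGL (u, (1 : GL (Fin 1) (LocalRing E v))) := by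
    rw [hh, map_adeleToLocal_adelicInl_inclPlaceAdelic, huπ, ContinuousMulEquiv.apply_symm_apply]
  have hg := kroneckerGL_one_mem_pairForm F E c N TV TW v hu
  obtain ⟨gW, hgW, -, hint⟩ := exists_gl_split_intertwine_adicCompletion F E c hcδ hδ hd N e TV hV hVd TW hW hWd v hs hg
  have hgWP : gW = P := Units.ext (hgW.trans hP)
  subst hgWP
  -- the `v`-component of `A_h x` is B-p04's local action `A (x_v)` at `g = u ⊗ 1`
  have hcomp := evalAt_vDiagAct_comp F E c hcδ hδ hd N e TV hV hVd TW hW hWd v h x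
  rw [hGL] at hcomp
  set y := evalAt F (Fin (n + n)) v x with hy
  set Ay := SymplecticMatrix.darboux ((UnitaryDualPair.gram F e TV TW).map (algebraMap F (v.adicCompletion F)))
      (isUnit_det_gram_map_adicCompletion F N e TV hVd TW hWd v)
      (reindexW (v.adicCompletion F) e
        ((isQuadraticCoordinates_local E v c hcδ hδ hd).resAut (Fin N × Fin 1) (kroneckerGL (u, (1 : GL (Fin 1) (LocalRing E v))))
          ((reindexW (v.adicCompletion F) e).symm
            ((SymplecticMatrix.darboux ((UnitaryDualPair.gram F e TV TW).map (algebraMap F (v.adicCompletion F)))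
                (isUnit_det_gram_map_adicCompletion F N e TV hVd TW hWd v)).symm (y ∘ ⇑finSumFinEquiv))))) with hAy
  have h1 : (fun i => evalAt F (Fin (n + n)) v (vDiagAct F E c hcδ hδ hd N e TV hV hVd TW hW hWd h x) (Fin.castAdd n i)) =
      Ay ∘ Sum.inl := by
    funext i
    have := congrFun hcomp (Sum.inl i)
    simp only [Function.comp_apply, finSumFinEquiv_apply_left] at this
    exact this
  have h2 : (fun i => evalAt F (Fin (n + n)) v (vDiagAct F E c hcδ hδ hd N e TV hV hVd TW hW hWd h x) (Fin.natAdd n i)) =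
      Ay ∘ Sum.inr := by
    funext i
    have := congrFun hcomp (Sum.inr i)
    simp only [Function.comp_apply, finSumFinEquiv_apply_right] at this
    exact this
  have hint' := hint y
  rw [← hAy] at hint'
  rw [hβ, hβ, h1, h2]
  exact Prod.ext hint'.1 hint'.2

include hδ in
/-- **THE SPLIT-PLACE FRAME of the I-CLOSE assembly (binder (SPLIT-v ∘ BRIDGE-v))**: at a finite place `v` of `F` with `s² = d` in
`F_v` (split in `E = F(δ)`) there is a linear isomorphism `β_v : X□(F_v) ≃ X_v × Y_v` (`X_v = Y_v = F_v^n`) such that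
(E1) the hermitian norm read at `v` is the split pairing, `(hNorm x)_v = (β_v x_v).1 ⬝ᵥ (β_v x_v).2` (★ `evalAt_hNorm`,
★ `exists_splitBeta_adicCompletion`); (E2) `β_v` carries Haar measure to a positive multiple of the product Haar measure;
(E3) every `P ∈ GL_n(F_v)` is realised by a `v`-supported `h ∈ U(J_V)(𝔸_F)` fixing `X□(𝔸_F)^{(v)}` pointwise and acting at `v` as
`(P, (P⁻¹)ᵀ)` in the coordinates `β_v` (`exists_vSupported_realising`).  With ★ `AdelicVector.placeSplitting` the composite
`e := (β_v × id) ∘ placeSplitting⁻¹ : X□(𝔸_F) ≃ (X_v × Y_v) × X□(𝔸_F)^{(v)}` has the `hNorm`-clause and the `U(J_V)(F_v) ↠ GL_n(F_v)`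
intertwining clause of Weil's n° 50 (`X_A = X_v × X′`, `U(i)_v ≅ GL(m, 𝔎_v)`).
[cite: Weil1965, Chap. V n° 50, pp. 73–74] -/
theorem exists_splitPlaceFrame {s : v.adicCompletion F} (hs : s * s = algebraMap F (v.adicCompletion F) d)
    [MeasurableSpace (v.adicCompletion F)] [BorelSpace (v.adicCompletion F)]
    (μ : Measure (v.adicCompletion F)) [μ.IsAddHaarMeasure] :
    ∃ β : (Fin (n + n) → v.adicCompletion F) ≃ₗ[v.adicCompletion F] ((Fin n → v.adicCompletion F) × (Fin n → v.adicCompletion F)),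
      (∀ x : Fin (n + n) → AdeleRing (𝓞 F) F,
        AdelicGroupData.adeleEval F v (hNorm F E c hcδ hδ N e TV hVd TW hWd x) =
          (β (evalAt F (Fin (n + n)) v x)).1 ⬝ᵥ (β (evalAt F (Fin (n + n)) v x)).2) ∧
      (∃ cst : ℝ≥0, 0 < cst ∧
        Measure.map β (Measure.pi fun _ : Fin (n + n) => μ) =
          (cst : ℝ≥0∞) • ((Measure.pi fun _ : Fin n => μ).prod (Measure.pi fun _ : Fin n => μ))) ∧
      (∀ P : GL (Fin n) (v.adicCompletion F), ∃ h : UnitaryGroup.adelic F E c N (TV.map (algebraMap F E)),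
        (∀ y ∈ trivialAt F (Fin (n + n)) v, vDiagAct F E c hcδ hδ hd N e TV hV hVd TW hW hWd h y = y) ∧
        (∀ x : Fin (n + n) → AdeleRing (𝓞 F) F,
          β (evalAt F (Fin (n + n)) v (vDiagAct F E c hcδ hδ hd N e TV hV hVd TW hW hWd h x)) =
            ((P : Matrix (Fin n) (Fin n) (v.adicCompletion F)) *ᵥ (β (evalAt F (Fin (n + n)) v x)).1,
              ((P⁻¹ : GL (Fin n) (v.adicCompletion F)) : Matrix (Fin n) (Fin n) (v.adicCompletion F))ᵀ *ᵥ
                (β (evalAt F (Fin (n + n)) v x)).2)) ∧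
        (∀ x : Fin (n + n) → AdeleRing (𝓞 F) F,
          ((placeSplitting F (Fin (n + n)) v).symm (vDiagAct F E c hcδ hδ hd N e TV hV hVd TW hW hWd h x)).2 =
            ((placeSplitting F (Fin (n + n)) v).symm x).2)) := by
  obtain ⟨β, hβ, -, hQ, hHaar⟩ := exists_splitBeta_adicCompletion F E hδ hd N e TV hV hVd TW hW hWd v μ hs
  refine ⟨β, fun x => ?_, hHaar, fun P => exists_vSupported_realising F E c hcδ hδ hd N e TV hV hVd TW hW hWd v hs β hβ P⟩
  rw [evalAt_hNorm F E c hcδ hδ hd N e TV hVd TW hWd v x]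
  exact hQ _


/-- **INVARIANCE TRANSPORT through the frame `e := (β_v × id) ∘ placeSplitting⁻¹`**: if a measure `μ` on `X□(𝔸_F)` is invariant
under `A_h` for an `h` as in `exists_vSupported_realising` (clauses (i), (ii)), then its `e`-image on `(X_v × Y_v) × X□(𝔸_F)^{(v)}` is
invariant under `(P ·, (P⁻¹)ᵀ ·) × id` — the hypothesis `hinv` of ★ `H413E2SWIdentityCloseSplit.marginal_eq_smul_marginal_of_dilate_bound`
follows by evaluating on rectangles (★ `AdelicVector.map_prodMap_map_placeSplitting_symm`; Weil (1965) n° 50: «les `μ_i` sont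
invariantes par `G′`»). [cite: Weil1965, Chap. V n° 50, pp. 73–74] -/
theorem map_dualAct_frame_eq [MeasurableSpace (AdeleRing (𝓞 F) F)] [BorelSpace (AdeleRing (𝓞 F) F)]
    [MeasurableSpace (v.adicCompletion F)] [BorelSpace (v.adicCompletion F)]
    (β : (Fin (n + n) → v.adicCompletion F) ≃ₗ[v.adicCompletion F] ((Fin n → v.adicCompletion F) × (Fin n → v.adicCompletion F)))
    (P : GL (Fin n) (v.adicCompletion F)) (h : UnitaryGroup.adelic F E c N (TV.map (algebraMap F E)))
    (hfix : ∀ y ∈ trivialAt F (Fin (n + n)) v, vDiagAct F E c hcδ hδ hd N e TV hV hVd TW hW hWd h y = y)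
    (hii : ∀ x : Fin (n + n) → AdeleRing (𝓞 F) F,
      β (evalAt F (Fin (n + n)) v (vDiagAct F E c hcδ hδ hd N e TV hV hVd TW hW hWd h x)) =
        ((P : Matrix (Fin n) (Fin n) (v.adicCompletion F)) *ᵥ (β (evalAt F (Fin (n + n)) v x)).1,
          ((P⁻¹ : GL (Fin n) (v.adicCompletion F)) : Matrix (Fin n) (Fin n) (v.adicCompletion F))ᵀ *ᵥ
            (β (evalAt F (Fin (n + n)) v x)).2))
    (μ : Measure (Fin (n + n) → AdeleRing (𝓞 F) F))
    (hμ : Measure.map (vDiagAct F E c hcδ hδ hd N e TV hV hVd TW hW hWd h) μ = μ) :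
    Measure.map (Prod.map (fun q : (Fin n → v.adicCompletion F) × (Fin n → v.adicCompletion F) =>
        ((P : Matrix (Fin n) (Fin n) (v.adicCompletion F)) *ᵥ q.1,
          ((P⁻¹ : GL (Fin n) (v.adicCompletion F)) : Matrix (Fin n) (Fin n) (v.adicCompletion F))ᵀ *ᵥ q.2)) id)
      (Measure.map (Prod.map β id) (Measure.map (placeSplitting F (Fin (n + n)) v).symm μ)) =
      Measure.map (Prod.map β id) (Measure.map (placeSplitting F (Fin (n + n)) v).symm μ) := by
  haveI := secondCountableTopology_adicCompletion F v
  haveI := AdelicVector.secondCountableTopology_piLocal F (Fin (n + n)) v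
  haveI := AdelicVector.secondCountableTopology_piLocal F (Fin n) v
  haveI : BorelSpace (Fin (n + n) → v.adicCompletion F) := Pi.borelSpace
  haveI : BorelSpace (Fin n → v.adicCompletion F) := Pi.borelSpace
  haveI : BorelSpace ((Fin n → v.adicCompletion F) × (Fin n → v.adicCompletion F)) := Prod.borelSpace
  -- the local operator and its measurability
  set L := vDiagAct F E c hcδ hδ hd N e TV hV hVd TW hW hWd h with hL
  set Lv : (Fin (n + n) → v.adicCompletion F) → (Fin (n + n) → v.adicCompletion F) :=
    fun a => evalAt F (Fin (n + n)) v (L (single F (Fin (n + n)) v a)) with hLv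
  have hLvm : Measurable Lv := (continuous_evalAt_vDiagAct_single F E c hcδ hδ hd N e TV hV hVd TW hW hWd v h).measurable
  have hν := AdelicVector.map_prodMap_map_placeSplitting_symm L.toLinearMap hfix Lv hLvm (fun _ => rfl) μ hμ
  -- `β ∘ Lv = dual P ∘ β`
  set D : (Fin n → v.adicCompletion F) × (Fin n → v.adicCompletion F) → (Fin n → v.adicCompletion F) × (Fin n → v.adicCompletion F) :=
    fun q => ((P : Matrix (Fin n) (Fin n) (v.adicCompletion F)) *ᵥ q.1,
      ((P⁻¹ : GL (Fin n) (v.adicCompletion F)) : Matrix (Fin n) (Fin n) (v.adicCompletion F))ᵀ *ᵥ q.2) with hD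
  have hβL : ∀ a, β (Lv a) = D (β a) := fun a => by
    have := hii (single F (Fin (n + n)) v a)
    rw [evalAt_single] at this
    exact this
  have hcomp : Prod.map (⇑β) (id : trivialAt F (Fin (n + n)) v → trivialAt F (Fin (n + n)) v) ∘ Prod.map Lv id =
      Prod.map D id ∘ Prod.map (⇑β) id := by
    funext q
    rcases q with ⟨a, t⟩
    show (β (Lv a), t) = (D (β a), t)
    rw [hβL]
  -- measurability
  have hβc : Continuous β := by
    haveI : ContinuousSMul (v.adicCompletion F) (v.adicCompletion F) := ⟨continuous_mul⟩
    exact β.toLinearMap.continuous_on_pi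
  have hβm : Measurable (Prod.map (⇑β) (id : trivialAt F (Fin (n + n)) v → trivialAt F (Fin (n + n)) v)) :=
    hβc.measurable.prodMap measurable_id
  have hDc : Continuous D :=
    (continuous_const.matrix_mulVec continuous_fst).prodMk (continuous_const.matrix_mulVec continuous_snd)
  have hDm : Measurable (Prod.map D (id : trivialAt F (Fin (n + n)) v → trivialAt F (Fin (n + n)) v)) :=
    hDc.measurable.prodMap measurable_id
  have hLm : Measurable (Prod.map Lv (id : trivialAt F (Fin (n + n)) v → trivialAt F (Fin (n + n)) v)) :=
    hLvm.prodMap measurable_id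
  rw [Measure.map_map hDm hβm, ← hcomp, ← Measure.map_map hβm hLm, hν]

end Summit.HodgeConjecture.HodgeConjecture.Cruxes.H413.E2SWSplitPlaceFrame
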